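import Literature.Algebra.EuclideanLattices.LatticeDescentFourier
import HarnessLib

/-!
# Unfolding summable periodizations against periodic factors

Topic `Literature/Algebra/EuclideanLattices`, continuing `LatticePeriodicFunctions` and
`LatticeDescentFourier` (full lattice `L ≤ E`, fundamental parallelepiped `fdom L`, characters
`echar L k`, `mean L μ`, periodization `periodize L h x = ∑' ℓ : L, h (x + ℓ)`). Everything here is
PROVED.

The unfolding identities `integral_fdom_periodize_mul` / `mean_echar_mul_periodize` of
`LatticeDescentFourier` assume that `h` is supported in a ball, so that the periodization is a
locally finite sum. For kernels with only polynomial decay (lattice sums of the Lennard-Jones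
kernel, Epstein zeta regularisations, Poisson summation for integrable `h`) one needs the same
identities for an integrable `h` whose periodization is merely **normally summable on a period**:
`|h (x + ℓ)| ≤ M ℓ` for `x ∈ fdom L` with `∑ M ℓ < ∞`. We prove

* `integral_fdom_periodize_mul_of_summable` — **unfolding with a periodic factor**:
  `∫_{fdom} (∑_ℓ h(x+ℓ)) e(x) dx = ∫_E h e` for `h` continuous and integrable with normally
  summable periodization and `e` continuous, bounded and `L`-periodic (dominated convergence for
  series on the finite-measure set `fdom L`, then the fundamental-domain decomposition of `∫_E`);
* `mean_echar_mul_periodize_of_summable` — **the Fourier coefficients of a periodization**: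
  `mean(e_{−k} · periodize h) = (μ(fdom))⁻¹ ∫_E h e_{−k}`, i.e. the lattice form of the Poisson
  summation dictionary "Fourier coefficient of the periodization = Fourier transform of `h` at the
  dual lattice point".

What is NOT here: pointwise Poisson summation (convergence of the Fourier series of the
periodization), and any statement for `h` that is only integrable (where the unfolding holds
a.e. but `periodize` need not converge everywhere).

## References

* L. Grafakos, *Classical Fourier Analysis*, 3rd ed., Springer GTM 249 (2014), §3.1 (the torus,
  Fourier coefficients) and Thm. 3.2.8 (Poisson summation: the Fourier coefficients of the
  periodization of an integrable function). [cite: Grafakos2014, §3.1]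
* E. M. Stein, G. Weiss, *Introduction to Fourier Analysis on Euclidean Spaces*, Princeton (1971),
  Ch. VII §2 (periodization of `L¹` functions and Poisson summation). [cite: SteinWeiss1971, VII §2]

## Mathlib / tree search

Tree: `LatticePeriodic.integral_fdom_periodize_mul`, `LatticePeriodic.mean_echar_mul_periodize`
(compact support), `isAddFundamentalDomain`, `integrableOn_fdom`, `measure_fdom_lt_top`,
`echar_add_of_mem`, `norm_echar`. Mathlib: `IsAddFundamentalDomain.integral_eq_tsum''`,
`integral_tsum_of_summable_integral_norm`, `norm_setIntegral_le_of_norm_le_const`,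
`Integrable.mul_bdd`, `Complex.ofReal_tsum`, `tsum_mul_right`,
`instCountable_of_discrete_submodule`.
-/

noncomputable section

open MeasureTheory Module Submodule Filter Topology Complex Finset ZSpan
open scoped Real

namespace Literature.Algebra.EuclideanLattices.LatticePeriodic

variable {E : Type*} [NormedAddCommGroup E] [NormedSpace ℝ E] [FiniteDimensional ℝ E]
variable {L : Submodule ℤ E} [DiscreteTopology L] [IsZLattice ℝ L]
variable [MeasurableSpace E] [BorelSpace E] (μ : Measure E) [μ.IsAddHaarMeasure]

/-! ## Unfolding a normally summable periodization -/

/-- **Unfolding with a periodic factor, summable version**: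
`∫_{fdom} (∑_ℓ h(x+ℓ)) e(x) dx = ∫_E h e` for `h` continuous and integrable whose lattice
translates are dominated on the fundamental domain by a summable sequence
(`|h (x + ℓ)| ≤ M ℓ` for `x ∈ fdom L`, `∑ M ℓ < ∞`), and `e` continuous, bounded and `L`-periodic.
Proof: `∫_E h e = ∑_ℓ ∫_{fdom} h(x+ℓ) e(x+ℓ) dx` (fundamental domain), `e(x+ℓ) = e(x)`, and the
sum of the integrals over the finite-measure set `fdom L` is the integral of the sum because
`∑_ℓ ∫_{fdom} |h(x+ℓ)| ‖e(x)‖ dx ≤ (∑_ℓ M ℓ) · B · μ(fdom) < ∞`. [folklore] -/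
theorem integral_fdom_periodize_mul_of_summable {h : E → ℝ} (hc : Continuous h) (hint : Integrable h μ)
    {M : L → ℝ} (hM : Summable M) (hbd : ∀ (ℓ : L) (x : E), x ∈ fdom L → |h (x + ℓ)| ≤ M ℓ)
    {e : E → ℂ} (he : Continuous e) (hpe : ∀ ℓ ∈ L, ∀ x, e (x + ℓ) = e x) {B : ℝ} (heB : ∀ x, ‖e x‖ ≤ B) :
    ∫ x in fdom L, (periodize L h x : ℂ) * e x ∂μ = ∫ x, (h x : ℂ) * e x ∂μ := by
  have : MeasurableVAdd L E := (inferInstance : MeasurableVAdd L.toAddSubgroup E)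
  have : VAddInvariantMeasure L E μ := (inferInstance : VAddInvariantMeasure L.toAddSubgroup E μ)
  -- `h e` is integrable (integrable times bounded continuous)
  have hint' : Integrable (fun x => (h x : ℂ) * e x) μ :=
    hint.ofReal.mul_bdd he.aestronglyMeasurable (Eventually.of_forall heB)
  rw [(isAddFundamentalDomain L μ).integral_eq_tsum'' _ hint']
  have hvadd : ∀ (ℓ : L) (x : E), ℓ +ᵥ x = x + (ℓ : E) := fun ℓ x => by
    rw [Submodule.vadd_def, vadd_eq_add, add_comm]
  simp_rw [hvadd]
  -- periodicity of `e`
  have hpe' : ∀ (ℓ : L) (x : E), e (x + (ℓ : E)) = e x := fun ℓ x => hpe _ ℓ.2 x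
  simp_rw [hpe']
  -- each term is integrable on `fdom`
  have hF : ∀ ℓ : L, Integrable (fun x : E => (h (x + (ℓ : E)) : ℂ) * e x) (μ.restrict (fdom L)) :=
    fun ℓ => (integrableOn_fdom L μ (by fun_prop) : IntegrableOn (fun x : E => (h (x + (ℓ : E)) : ℂ) * e x) (fdom L) μ)
  -- the integrals of the norms are summable: `∫_{fdom} |h(x+ℓ)| ‖e x‖ ≤ M ℓ · B · μ(fdom)`
  have hnorm : ∀ ℓ : L, ∫ x in fdom L, ‖(h (x + (ℓ : E)) : ℂ) * e x‖ ∂μ ≤ M ℓ * B * μ.real (fdom L) := by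
    intro ℓ
    have h1 : ‖∫ x in fdom L, ‖(h (x + (ℓ : E)) : ℂ) * e x‖ ∂μ‖ ≤ M ℓ * B * μ.real (fdom L) := by
      refine norm_setIntegral_le_of_norm_le_const (measure_fdom_lt_top L μ) fun x hx => ?_
      rw [norm_norm, norm_mul, Complex.norm_real, Real.norm_eq_abs]
      exact mul_le_mul (hbd ℓ x hx) (heB x) (norm_nonneg _) ((abs_nonneg _).trans (hbd ℓ x hx))
    exact (Real.le_norm_self _).trans h1
  have hsum : Summable fun ℓ : L => ∫ x in fdom L, ‖(h (x + (ℓ : E)) : ℂ) * e x‖ ∂μ :=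
    Summable.of_nonneg_of_le (fun ℓ => integral_nonneg fun x => norm_nonneg _) hnorm
      ((hM.mul_right B).mul_right _)
  rw [integral_tsum_of_summable_integral_norm hF hsum]
  -- pointwise: `periodize h x · e x = ∑_ℓ h(x+ℓ) e x`
  refine setIntegral_congr_fun (fdom_measurableSet L) fun x _ => ?_
  rw [periodize, Complex.ofReal_tsum, tsum_mul_right]

/-- **The Fourier coefficients of a periodization, summable version**: for `g = periodize L h`
with `h` continuous, integrable and with normally summable periodization on the fundamental
domain, `mean(e_{−k} g) = (μ(fdom))⁻¹ ∫_E h e_{−k}` — the Fourier coefficient of the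
periodization is the Fourier transform of `h` at the dual lattice point (Poisson summation
dictionary). [folklore] -/
theorem mean_echar_mul_periodize_of_summable {h : E → ℝ} (hc : Continuous h) (hint : Integrable h μ)
    {M : L → ℝ} (hM : Summable M) (hbd : ∀ (ℓ : L) (x : E), x ∈ fdom L → |h (x + ℓ)| ≤ M ℓ)
    (k : Fin (finrank ℝ E) → ℤ) :
    mean L μ (fun x => echar L (-k) x * (periodize L h x : ℂ)) =
      (μ.real (fdom L))⁻¹ * ∫ x, (h x : ℂ) * echar L (-k) x ∂μ := by
  rw [mean, Complex.real_smul]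
  congr 1
  rw [← integral_fdom_periodize_mul_of_summable μ hc hint hM hbd (continuous_echar L (-k))
    (fun ℓ hℓ x => echar_add_of_mem L (-k) hℓ x) (fun x => (norm_echar L (-k) x).le)]
  exact setIntegral_congr_fun (fdom_measurableSet L) fun x _ => mul_comm _ _

end Literature.Algebra.EuclideanLattices.LatticePeriodic
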